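import Literature.Computability.AlgebraicComplexity.SmallFormatRankProofs
import Literature.Computability.AlgebraicComplexity.LafonWinogradRankBound
import Literature.Computability.AlgebraicComplexity.MatMulTwoTwoNRankUpper
import Literature.Computability.AlgebraicComplexity.SmallFormatMatMulRankUpper
import Literature.Computability.AlgebraicComplexity.KroneckerRank
import Literature.Computability.AlgebraicComplexity.TensorRestrictionRank
import Literature.Computability.AlgebraicComplexity.MatrixMultiplicationExponent
import Literature.Computability.AlgebraicComplexity.MatMul336Rank40Smirnov
import Literature.Computability.AlgebraicComplexity.MatMul336Rank42KauersMoosbauer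
import Literature.Computability.AlgebraicComplexity.MatMul246Rank39HopcroftKerr
import Literature.Computability.AlgebraicComplexity.MatMul256Rank47AlphaEvolve
import Literature.Computability.AlgebraicComplexity.MatMul266Rank56KauersMoosbauer
import Literature.Computability.AlgebraicComplexity.MatMul346Rank54AlphaEvolve
import Literature.Computability.AlgebraicComplexity.MatMul346Rank56KauersMoosbauer
import Literature.Computability.AlgebraicComplexity.MatMul356Rank68AlphaEvolve
import Literature.Computability.AlgebraicComplexity.MatMul446Rank73Smirnov
import Literature.Computability.AlgebraicComplexity.MatMul446Rank74KauersMoosbauer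
import Literature.Computability.AlgebraicComplexity.MatMul456Rank90KauersWood
import Literature.Computability.AlgebraicComplexity.MatMul556Rank110KauersWood
import Literature.Computability.AlgebraicComplexity.MatMul566Rank130KauersWood
import Summits.MatrixMultiplication.OmegaCensus.SmallFormats.RankRowIncrement
import Summits.MatrixMultiplication.OmegaCensus.SmallFormats.MatMul444Rank49
import Summits.MatrixMultiplication.OmegaCensus.SmallFormats.RankWindow666
import HarnessLib

/-!
# ω-census family (a): the kernel-certified rank WINDOWS for every format with a dimension `6`
# (`⟨k,m,6⟩`, `2 ≤ k ≤ m ≤ 6`), over every field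

Cell `pub-omega` (HOME `run/shared/lean/pub/pub-omega/`, unit `pub-omega-lit`), topic
`Summits/MatrixMultiplication/OmegaCensus`; sibling of `RankWindows.lean` (all dimensions `≤ 5`) and
`RankWindow666.lean`.  Framing (verbatim): lottery ticket; floor = certified bounds/negative ranges.
HONEST FRAMING: this file proves NOTHING new — it assembles, one theorem per format, a lower and an
upper bound that are ALREADY kernel theorems in `Literature/` (or one gluing / Kronecker step away from
them), so that the census table can cite one declaration per format.  `R(⟨k,m,n⟩)` is invariant under
all permutations of `(k,m,n)` (`tensorRank_matMulTensor_rotate/transpose`), so each window is stated for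
the sorted format and the best ordering is used inside the proof.

Lower ends (every field `K : Type`): Lafon–Winograd / BCS (17.12) `R(⟨c,m,n⟩) ≥ cm + m(n−1) + (n−1)`
(`lafonWinograd_le_tensorRank_matMulTensor`, best ordering) for `226, 236, 246, 256, 266, 366`;
Bläser 2003 Thm. 14 `R(⟨n,m,n⟩) ≥ 2mn + 2n − m − 2` (`blaser2003_thm14_holds`) for `336, 446, 556`
(and `666`, `RankWindow666.lean`); Thm. 14 plus the column-substitution step
(`RankRowIncrement.blaser2003_thm14_add_cols`: `+ d·m` for `d` extra columns) for `346, 356, 456, 466,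
566`.  These equal Bläser's 1999 bound `cm + mn + c − m + n − 3` except at `356 / 366 / 466`, where the
1999 bound (not in the tree; paywalled, acq-09190) would give `47 / 54 / 61`.

Upper ends: the explicit published schemes kernel-checked in `Literature/` (Hopcroft–Kerr 1971,
Smirnov 2013 / 2023, Kauers–Moosbauer 2023, AlphaEvolve 2025, Kauers–Wood 2025, Moosbauer–Poole 2025),
plus gluing `R(⟨k,m,n₁+n₂⟩) ≤ R(⟨k,m,n₁⟩) + R(⟨k,m,n₂⟩)` (and its row / inner forms) and Bläser 2013
Lemma 5.8 (Kronecker submultiplicativity) for the two composite entries `366 = 2·⟨3,3,6⟩` and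
`466 = ⟨2,2,2⟩ ⊗ ⟨2,3,3⟩` of the Sedoglavic catalogue.  Three schemes have non-integral coefficients:
`336:40` and `346:54` (`ℤ[1/2]`), `446:73` (`ℤ[1/6]`); for those the window is given twice — over every
field with the weaker all-characteristic ceiling, and under the characteristic proviso.

| format | window, every field | with proviso | print (best known; char 0) |
|---|---|---|---|
| 226 | [19, 21] | | [19, 21] (Hopcroft–Kerr 1971) |
| 236 | [26, 30] | | [26, 30] |
| 246 | [33, 39] | | [33, 39] (Hopcroft–Kerr 1971) |
| 256 | [40, 47] | | [40, 47] (AlphaEvolve 2025) |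
| 266 | [47, 56] | | [47, 56] (Kauers–Moosbauer 2023) |
| 336 | [34, 44]; [34, 42] (`window_336_anyChar`, 2026-08-22 addendum) | [34, 40] (`2 ≠ 0`) | [34, 40] (Smirnov 2013); 42 over every ring (Kauers–Moosbauer 2023) |
| 346 | [40, 56] | [40, 54] (`2 ≠ 0`) | [40, 54] (AlphaEvolve 2025); 56 integral (Kauers–Moosbauer 2023) |
| 356 | [46, 68] | | [47, 68] (Bläser 1999; AlphaEvolve 2025) |
| 366 | [53, 86] | [53, 80] (`2 ≠ 0`) | [54, 80] (Bläser 1999; 2·⟨3,3,6:40⟩) |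
| 446 | [48, 75]; [48, 74] (`window_446_anyChar`, addendum) | [48, 73] (`3 ≠ 0`) | [48, 73] (Smirnov 2023, catalogue); 74 over every ring (Kauers–Moosbauer 2023) |
| 456 | [54, 90] | | [54, 90] (Kauers–Wood 2025 / AlphaEvolve 2025) |
| 466 | [60, 105] | | [61, 105] (Bläser 1999; ⟨2,2,2:7⟩ ⊗ ⟨2,3,3:15⟩) |
| 556 | [62, 110] | | [62, 110] (Kauers–Wood 2025) |
| 566 | [68, 130] | | [68, 130] (Kauers–Wood 2025) |
| 666 | [76, 153] | | [76, 153] (Moosbauer–Poole 2025) — `RankWindow666.window_666` |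
-/

namespace Summit.MatrixMultiplication.OmegaCensus

open Literature.Computability.AlgebraicComplexity

namespace RankWindows

variable (K : Type) [Field K]

/-- `R(⟨k,m,n⟩) = R(⟨k,n,m⟩)` (swap of the last two dimensions; rotate then transpose).
[cite: BurgisserClausenShokrollahi1997, Rem. (17.13)(3)] -/
theorem tensorRank_matMulTensor_swap_mid_right (k m n : ℕ) :
    tensorRank (matMulTensor K k m n) = tensorRank (matMulTensor K k n m) := by
  rw [tensorRank_matMulTensor_rotate K k m n, tensorRank_matMulTensor_transpose K m n k]

/-! ### `⟨2, m, 6⟩` -/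

/-- `19 ≤ R(⟨2,2,6⟩) ≤ 21` over every field (Lafon–Winograd; Hopcroft–Kerr `⌈7·6/2⌉`).
[cite: BurgisserClausenShokrollahi1997, Thm (17.12)] [cite: HopcroftKerr1971, abstract (case p = 2)] -/
theorem window_226 : tensorRank (matMulTensor K 2 2 6) ∈ Set.Icc 19 21 := by
  refine ⟨?_, ?_⟩
  · simpa using lafonWinograd_le_tensorRank_matMulTensor K (c := 2) (m := 2) (n := 6)
      (by norm_num) (by norm_num) (by norm_num)
  · simpa using hopcroftKerr1971_tensorRank_matMulTensor_22n_le (K := K) 6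

/-- `26 ≤ R(⟨2,3,6⟩) ≤ 30` over every field (Lafon–Winograd; two Hopcroft–Kerr blocks `⟨2,3,3:15⟩`).
[cite: BurgisserClausenShokrollahi1997, Thm (17.12)] -/
theorem window_236 : tensorRank (matMulTensor K 2 3 6) ∈ Set.Icc 26 30 := by
  refine ⟨?_, ?_⟩
  · simpa using lafonWinograd_le_tensorRank_matMulTensor K (c := 2) (m := 3) (n := 6)
      (by norm_num) (by norm_num) (by norm_num)
  · have h := tensorRank_matMulTensor_add_right_le (K := K) 2 3 3 3
    have h15 := tensorRank_matMulTensor_233_le K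
    simpa using h.trans (Nat.add_le_add h15 h15)

/-- `33 ≤ R(⟨2,4,6⟩) ≤ 39` over every field (Lafon–Winograd; Hopcroft–Kerr 1971 `p × 2 × n`).
[cite: BurgisserClausenShokrollahi1997, Thm (17.12)] [cite: HopcroftKerr1971, abstract] -/
theorem window_246 : tensorRank (matMulTensor K 2 4 6) ∈ Set.Icc 33 39 := by
  refine ⟨?_, tensorRank_matMulTensor_246_le K⟩
  simpa using lafonWinograd_le_tensorRank_matMulTensor K (c := 2) (m := 4) (n := 6)
    (by norm_num) (by norm_num) (by norm_num)

/-- `40 ≤ R(⟨2,5,6⟩) ≤ 47` over every field (Lafon–Winograd; AlphaEvolve 2025).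
[cite: BurgisserClausenShokrollahi1997, Thm (17.12)] [cite: NovikovEtAl2025, Table 2 (⟨2,5,6⟩: 48 → 47)] -/
theorem window_256 : tensorRank (matMulTensor K 2 5 6) ∈ Set.Icc 40 47 := by
  refine ⟨?_, tensorRank_matMulTensor_256_le K⟩
  simpa using lafonWinograd_le_tensorRank_matMulTensor K (c := 2) (m := 5) (n := 6)
    (by norm_num) (by norm_num) (by norm_num)

/-- `47 ≤ R(⟨2,6,6⟩) ≤ 56` over every field (Lafon–Winograd; Kauers–Moosbauer 2023).
[cite: BurgisserClausenShokrollahi1997, Thm (17.12)] [cite: KauersMoosbauer2023, results table (2,6,6): 57 → 56] -/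
theorem window_266 : tensorRank (matMulTensor K 2 6 6) ∈ Set.Icc 47 56 := by
  refine ⟨?_, tensorRank_matMulTensor_266_le K⟩
  simpa using lafonWinograd_le_tensorRank_matMulTensor K (c := 2) (m := 6) (n := 6)
    (by norm_num) (by norm_num) (by norm_num)

/-! ### `⟨3, m, 6⟩` -/

/-- `34 ≤ R(⟨3,3,6⟩)` over every field: Bläser 2003 Thm. 14 at `⟨3,6,3⟩` (`36 + 6 − 6 − 2`).
[cite: Blaser2003, Theorem 14] -/
theorem thirtyfour_le_tensorRank_matMulTensor_336 : 34 ≤ tensorRank (matMulTensor K 3 3 6) := by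
  have h := blaser2003_thm14_holds K 6 3 le_rfl (by norm_num)
  rw [tensorRank_matMulTensor_rotate K 3 3 6]
  simpa using h

/-- `34 ≤ R(⟨3,3,6⟩) ≤ 44` over EVERY field (upper: gluing `⟨3,3,2:15⟩ + ⟨3,3,4:29⟩`, every ring;
the record `40` needs `2` to be a unit, `window_336_of_two_ne_zero`). [cite: Blaser2003, Theorem 14]
[cite: Blaser2013, Lemma 5.5] -/
theorem window_336 : tensorRank (matMulTensor K 3 3 6) ∈ Set.Icc 34 44 := by
  refine ⟨thirtyfour_le_tensorRank_matMulTensor_336 K, ?_⟩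
  have h := tensorRank_matMulTensor_add_right_le (K := K) 3 3 2 4
  have h15 : tensorRank (matMulTensor K 3 3 2) ≤ 15 := by
    rw [tensorRank_matMulTensor_transpose K 3 3 2]; exact tensorRank_matMulTensor_233_le K
  have h29 := tensorRank_matMulTensor_334_le K
  simpa using h.trans (Nat.add_le_add h15 h29)

/-- `34 ≤ R(⟨3,3,6⟩) ≤ 40` over every field with `2 ≠ 0` (Smirnov 2013, scheme in `ℤ[1/2]`).
[cite: Blaser2003, Theorem 14] [cite: Smirnov2013, Table 1 (⟨3,3,6⟩: 40)] -/
theorem window_336_of_two_ne_zero (h2 : (2 : K) ≠ 0) :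
    tensorRank (matMulTensor K 3 3 6) ∈ Set.Icc 34 40 :=
  ⟨thirtyfour_le_tensorRank_matMulTensor_336 K,
    Smirnov2013_tensorRank_matMulTensor_336_le K (Ne.isUnit h2)⟩

/-- `40 ≤ R(⟨3,4,6⟩)` over every field: Bläser 2003 Thm. 14 at `⟨3,6,3⟩` plus one column
(`34 + 6`), then `R(⟨3,6,4⟩) = R(⟨3,4,6⟩)`. [cite: Blaser2003, Theorem 14] -/
theorem forty_le_tensorRank_matMulTensor_346 : 40 ≤ tensorRank (matMulTensor K 3 4 6) := by
  have h := RankRowIncrement.blaser2003_thm14_add_cols K 6 3 1 le_rfl (by norm_num)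
  rw [tensorRank_matMulTensor_swap_mid_right K 3 4 6]
  simpa using h

/-- `40 ≤ R(⟨3,4,6⟩) ≤ 56` over EVERY field (upper: Kauers–Moosbauer's printed integer scheme).
[cite: Blaser2003, Theorem 14] [cite: KauersMoosbauer2023, the printed rank-56 scheme for (3,4,6)] -/
theorem window_346 : tensorRank (matMulTensor K 3 4 6) ∈ Set.Icc 40 56 :=
  ⟨forty_le_tensorRank_matMulTensor_346 K, tensorRank_matMulTensor_346_le_fiftySix K⟩

/-- `40 ≤ R(⟨3,4,6⟩) ≤ 54` over every field with `2 ≠ 0` (AlphaEvolve 2025, scheme in `ℤ[1/2]`).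
[cite: Blaser2003, Theorem 14] [cite: NovikovEtAl2025, Table 2 (⟨3,4,6⟩: 56 → 54)] -/
theorem window_346_of_two_ne_zero (h2 : (2 : K) ≠ 0) :
    tensorRank (matMulTensor K 3 4 6) ∈ Set.Icc 40 54 :=
  ⟨forty_le_tensorRank_matMulTensor_346 K, tensorRank_matMulTensor_346_le K (Ne.isUnit h2)⟩

/-- `46 ≤ R(⟨3,5,6⟩) ≤ 68` over every field (Bläser 2003 Thm. 14 at `⟨3,6,3⟩` plus two columns,
`34 + 12`, via `R(⟨3,6,5⟩) = R(⟨3,5,6⟩)`; AlphaEvolve 2025). [cite: Blaser2003, Theorem 14]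
[cite: NovikovEtAl2025, Table 2 (⟨3,5,6⟩: 70 → 68)] -/
theorem window_356 : tensorRank (matMulTensor K 3 5 6) ∈ Set.Icc 46 68 := by
  refine ⟨?_, tensorRank_matMulTensor_356_le K⟩
  have h := RankRowIncrement.blaser2003_thm14_add_cols K 6 3 2 le_rfl (by norm_num)
  rw [tensorRank_matMulTensor_swap_mid_right K 3 5 6]
  simpa using h

/-- `53 ≤ R(⟨3,6,6⟩) ≤ 86` over EVERY field (Lafon–Winograd at `⟨3,6,6⟩`; upper: inner gluing
`⟨3,5,6:68⟩ + ⟨3,1,6:18⟩`; the catalogue's `80 = 2·⟨3,3,6:40⟩` needs `2 ≠ 0`,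
`window_366_of_two_ne_zero`). [cite: BurgisserClausenShokrollahi1997, Thm (17.12)]
[cite: Blaser2013, Lemma 5.5] -/
theorem window_366 : tensorRank (matMulTensor K 3 6 6) ∈ Set.Icc 53 86 := by
  refine ⟨?_, ?_⟩
  · simpa using lafonWinograd_le_tensorRank_matMulTensor K (c := 3) (m := 6) (n := 6)
      (by norm_num) (by norm_num) (by norm_num)
  · have h := tensorRank_matMulTensor_add_mid_le (K := K) 3 5 1 6
    have h68 := tensorRank_matMulTensor_356_le K
    have h18 := tensorRank_matMulTensor_le K 3 1 6
    simpa using h.trans (Nat.add_le_add h68 h18)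

/-- `53 ≤ R(⟨3,6,6⟩) ≤ 80` over every field with `2 ≠ 0` (two Smirnov blocks `⟨3,3,6:40⟩`,
`X Y = X₁ Y₁ + X₂ Y₂`). [cite: BurgisserClausenShokrollahi1997, Thm (17.12)]
[cite: Smirnov2013, Table 1 (⟨3,3,6⟩: 40)] [cite: Blaser2013, Lemma 5.5] -/
theorem window_366_of_two_ne_zero (h2 : (2 : K) ≠ 0) :
    tensorRank (matMulTensor K 3 6 6) ∈ Set.Icc 53 80 := by
  refine ⟨(window_366 K).1, ?_⟩
  have h := tensorRank_matMulTensor_add_mid_le (K := K) 3 3 3 6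
  have h40 := Smirnov2013_tensorRank_matMulTensor_336_le K (Ne.isUnit h2)
  simpa using h.trans (Nat.add_le_add h40 h40)

/-! ### `⟨4, m, 6⟩` -/

/-- `48 ≤ R(⟨4,4,6⟩)` over every field: Bläser 2003 Thm. 14 at `⟨4,6,4⟩` (`48 + 8 − 6 − 2`).
[cite: Blaser2003, Theorem 14] -/
theorem fortyeight_le_tensorRank_matMulTensor_446 : 48 ≤ tensorRank (matMulTensor K 4 4 6) := by
  have h := blaser2003_thm14_holds K 6 4 (by norm_num) (by norm_num)
  rw [tensorRank_matMulTensor_rotate K 4 4 6]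
  simpa using h

/-- `48 ≤ R(⟨4,4,6⟩) ≤ 75` over EVERY field (upper: gluing `⟨4,4,2:26⟩ + ⟨4,4,4:49⟩`, every ring;
`73` needs `3 ≠ 0`, `window_446_of_three_ne_zero`). [cite: Blaser2003, Theorem 14]
[cite: Blaser2013, Lemma 5.5] -/
theorem window_446 : tensorRank (matMulTensor K 4 4 6) ∈ Set.Icc 48 75 := by
  refine ⟨fortyeight_le_tensorRank_matMulTensor_446 K, ?_⟩
  have h := tensorRank_matMulTensor_add_right_le (K := K) 4 4 2 4
  have h26 : tensorRank (matMulTensor K 4 4 2) ≤ 26 := by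
    rw [tensorRank_matMulTensor_transpose K 4 4 2]; exact tensorRank_matMulTensor_244_le K
  have h49 := MatMul444Rank49.tensorRank_matMulTensor_le K
  simpa using h.trans (Nat.add_le_add h26 h49)

/-- `48 ≤ R(⟨4,4,6⟩) ≤ 73` over every field with `3 ≠ 0`: if also `2 ≠ 0`, Smirnov's 2023 scheme
(`ℤ[1/6]`, Sedoglavic catalogue); if `2 = 0`, gluing `⟨4,4,2:26⟩ + ⟨4,4,4:47⟩` (AlphaTensor's
characteristic-2 scheme). [cite: Blaser2003, Theorem 14]
[cite: SedoglavicFMMCatalogue, entry 4x4x6:73 (Smirnov 2023)]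
[cite: FawziEtAl2022, Fig. 3 (⟨4,4,4⟩: 47 in characteristic 2)] -/
theorem window_446_of_three_ne_zero (h3 : (3 : K) ≠ 0) :
    tensorRank (matMulTensor K 4 4 6) ∈ Set.Icc 48 73 := by
  refine ⟨fortyeight_le_tensorRank_matMulTensor_446 K, ?_⟩
  by_cases h2 : (2 : K) = 0
  · have h := tensorRank_matMulTensor_add_right_le (K := K) 4 4 2 4
    have h26 : tensorRank (matMulTensor K 4 4 2) ≤ 26 := by
      rw [tensorRank_matMulTensor_transpose K 4 4 2]; exact tensorRank_matMulTensor_244_le K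
    have h47 := tensorRank_matMulTensor_444_le_of_two_eq_zero K h2
    simpa using h.trans (Nat.add_le_add h26 h47)
  · exact tensorRank_matMulTensor_446_le_of_ne_zero K h2 h3

/-- `54 ≤ R(⟨4,5,6⟩) ≤ 90` over every field (Bläser 2003 Thm. 14 at `⟨4,6,4⟩` plus one column,
`48 + 6`, via `R(⟨4,6,5⟩) = R(⟨4,5,6⟩)`; Kauers–Wood 2025). [cite: Blaser2003, Theorem 14]
[cite: KauersWood2025, results table p. 3 ((4,5,6): 93 → 90)] -/
theorem window_456 : tensorRank (matMulTensor K 4 5 6) ∈ Set.Icc 54 90 := by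
  refine ⟨?_, tensorRank_matMulTensor_456_le K⟩
  have h := RankRowIncrement.blaser2003_thm14_add_cols K 6 4 1 (by norm_num) (by norm_num)
  rw [tensorRank_matMulTensor_swap_mid_right K 4 5 6]
  simpa using h

/-- `60 ≤ R(⟨4,6,6⟩) ≤ 105` over every field (Bläser 2003 Thm. 14 at `⟨4,6,4⟩` plus two columns;
upper: `⟨4,6,6⟩ ≅ ⟨2,2,2⟩ ⊗ ⟨2,3,3⟩`, Bläser 2013 Lemma 5.8, `7 · 15`). [cite: Blaser2003, Theorem 14]
[cite: Blaser2013, Lemma 5.8] -/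
theorem window_466 : tensorRank (matMulTensor K 4 6 6) ∈ Set.Icc 60 105 := by
  refine ⟨?_, ?_⟩
  · have h := RankRowIncrement.blaser2003_thm14_add_cols K 6 4 2 (by norm_num) (by norm_num)
    simpa using h
  · have e := tensorRank_kroneckerTensor_matMulTensor (K := K) 2 2 2 2 3 3
    have h := Blaser2013_lemma58 (matMulTensor K 2 2 2) (matMulTensor K 2 3 3)
    rw [e] at h
    have h7 := tensorRank_matMulTensor_two_le_seven K
    have h15 := tensorRank_matMulTensor_233_le K
    simpa using h.trans (Nat.mul_le_mul h7 h15)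

/-! ### `⟨5, m, 6⟩` (and `⟨6,6,6⟩` = `RankWindow666.window_666`) -/

/-- `62 ≤ R(⟨5,5,6⟩) ≤ 110` over every field (Bläser 2003 Thm. 14 at `⟨5,6,5⟩`, `60 + 10 − 6 − 2`;
Kauers–Wood 2025). [cite: Blaser2003, Theorem 14] [cite: KauersWood2025, results table p. 3 ((5,5,6): 116 → 110)] -/
theorem window_556 : tensorRank (matMulTensor K 5 5 6) ∈ Set.Icc 62 110 := by
  refine ⟨?_, tensorRank_matMulTensor_556_le K⟩
  have h := blaser2003_thm14_holds K 6 5 (by norm_num) (by norm_num)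
  rw [tensorRank_matMulTensor_rotate K 5 5 6]
  simpa using h

/-- `68 ≤ R(⟨5,6,6⟩) ≤ 130` over every field (Bläser 2003 Thm. 14 at `⟨5,6,5⟩` plus one column,
`62 + 6`; Kauers–Wood 2025). [cite: Blaser2003, Theorem 14]
[cite: KauersWood2025, §2 p. 2 and results table p. 3 ((5,6,6): 137 → 130)] -/
theorem window_566 : tensorRank (matMulTensor K 5 6 6) ∈ Set.Icc 68 130 := by
  refine ⟨?_, tensorRank_matMulTensor_566_le K⟩
  have h := RankRowIncrement.blaser2003_thm14_add_cols K 6 5 1 (by norm_num) (by norm_num)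
  simpa using h

/-! ### Addendum 2026-08-22: sharper all-characteristic ceilings for `336` and `446`
(Kauers–Moosbauer 2023's integer schemes `336:42` and `446:74`, kernel-checked in
`MatMul336Rank42KauersMoosbauer.lean` / `MatMul446Rank74KauersMoosbauer.lean`; the statements
`window_336` / `window_446` above stay as landed — theorems are append-only). -/

/-- `34 ≤ R(⟨3,3,6⟩) ≤ 42` over EVERY field (Bläser 2003 Thm. 14; Kauers–Moosbauer 2023's integer
scheme). [cite: Blaser2003, Theorem 14] [cite: KauersMoosbauer2023, results table row (3,3,6): ours 42] -/
theorem window_336_anyChar : tensorRank (matMulTensor K 3 3 6) ∈ Set.Icc 34 42 :=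
  ⟨thirtyfour_le_tensorRank_matMulTensor_336 K, tensorRank_matMulTensor_336_le_fortyTwo K⟩

/-- `48 ≤ R(⟨4,4,6⟩) ≤ 74` over EVERY field (Bläser 2003 Thm. 14; Kauers–Moosbauer 2023's integer
scheme). [cite: Blaser2003, Theorem 14] [cite: KauersMoosbauer2023, results table row (4,4,6): ours 74] -/
theorem window_446_anyChar : tensorRank (matMulTensor K 4 4 6) ∈ Set.Icc 48 74 :=
  ⟨fortyeight_le_tensorRank_matMulTensor_446 K, tensorRank_matMulTensor_446_le_seventyFour K⟩

/-! ### Addendum 2026-08-26: the all-characteristic ceiling `84` for `366`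
(Kauers–Moosbauer 2023, remark after the results table: "For the format (3,6,6), we only get down to
a scheme of rank 85, but as we reach 42 for the format (3,3,6), it is clear that the flip graph for
(3,6,6) must also have a path from the standard algorithm to a scheme of rank 2×42 = 84 < 85" — two
kernel-checked `⟨3,3,6:42⟩` blocks, every ring; `window_366` / `window_366_of_two_ne_zero` above stay
as landed). -/

/-- `53 ≤ R(⟨3,6,6⟩) ≤ 84` over EVERY field: Lafon–Winograd below; above, two Kauers–Moosbauer
integer blocks `⟨3,3,6:42⟩` glued along the middle index (`X Y = X₁ Y₁ + X₂ Y₂`), the printed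
`2 × 42 = 84 < 85`. [cite: KauersMoosbauer2023, results table row (3,3,6): ours 42, and the remark "2×42 = 84 < 85" for (3,6,6)]
[cite: BurgisserClausenShokrollahi1997, Thm (17.12)] [cite: Blaser2013, Lemma 5.5] -/
theorem window_366_anyChar : tensorRank (matMulTensor K 3 6 6) ∈ Set.Icc 53 84 := by
  refine ⟨(window_366 K).1, ?_⟩
  have h := tensorRank_matMulTensor_add_mid_le (K := K) 3 3 3 6
  have h42 := tensorRank_matMulTensor_336_le_fortyTwo K
  simpa using h.trans (Nat.add_le_add h42 h42)

end RankWindows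

end Summit.MatrixMultiplication.OmegaCensus
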